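import Summits.QuantumFields.YangMills.Theorems.MirrorModularBoostsSoftKernelBoostCovarianceAsmGeometryMargins
import Summits.QuantumFields.YangMills.Theorems.MirrorModularBoostsSoftKernelBoostCovarianceAsmGeometryRot
import Summits.QuantumFields.YangMills.Theorems.MirrorModularBoostsSoftKernelBoostCovarianceAsmSuperpositionTools
import Summits.QuantumFields.YangMills.Theorems.MirrorModularBoostsSoftKernelBoostCovarianceAsmConstantsAndBumps
import Summits.QuantumFields.YangMills.Theorems.MirrorModularBoostsSoftKernelBoostCovarianceSlotProductExpansionJoint
import Summits.QuantumFields.YangMills.Theorems.MirrorModularBoostsSoftKernelBoostCovarianceRadialRiemann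
import Summits.QuantumFields.YangMills.Theorems.MirrorModularBoostsSoftKernelBoostCovarianceAsmHeightsVitali
import Summits.QuantumFields.YangMills.Theorems.MirrorModularBoostsSoftKernelBoostCovarianceAsmBumpChainOps

/-!
# Assembly piece (Ui) — uniform planar boost vectors in every degree

Line `Sketch` of crux `MirrorModularBoosts.SoftKernelBoostCovariance` (stmt-QuantumFields-14999): part (i) of the lead's
assembly (T7) of the registered skeleton `Cruxes/SoftKernelBoostCovariance/Lines/Sketch.lean` (v3.5); conclusion (i) of
the registered `stub_chainBoostVectors` (T*) under its hypotheses (cone family, sandwich bound with exponent `μ`): for every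
degree `n` there is a type `N = n|μ|` such that for every compactly supported `e₀`-time-ordered `F` of degree `n` the field
vectors `Ψ_{R_θ F}` (`|θ| < ε`) are the real values of a family holomorphic on the strip `{|Re θ| < ε}` of exponential type `N`.

**Proof.**  Margins `δ, L` of `F` (`geom_margins`), `ε = δ/(4L)` (`isTimeOrdered_rot_of_margins`); bump-tensor
approximants `F_k = Σᵢ λ_{k,i} T_{k,i}` (landed T4a-joint `stub_slotProductExpansionJoint` with T4b `stub_radialRiemann`;
radius `ρ_k ≤ e^{-(k+1)}δ/32`, seminorm errors `< 1/(k+1)`, so `F_k → F` in `𝓢` by `tendsto_schwartz_of_seminorm` and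
`Ψ_{R_θ F_k} → Ψ_{R_θ F}` by `tendsto_fieldVec`); rotated centres of each term (`centres_rot`, joint localisation); the landed
(G) `stub_asmBumpChainOps` for every term at every height `m ≤ k` with `q = 0`, `w = 0`, reserve `u_m = e^{-(m+1)}δ/16`
(`cfg_zero_eq`); superposition (`fieldVec_finset_sum`, `isTimeOrdered_finset_sum`; bound `max M 0 · (max K_{u_m} 0)ⁿ ‖Ψ_1‖
≤ K e^{n|μ|m}` by `sandwichConst_pow_le`); the landed (A1) `stub_asmHeightsVitali`.

References: J. Glimm, A. Jaffe, *Quantum Physics* (2nd ed. 1987), §19.5–19.7; K. Osterwalder, R. Schrader, CMP 42 (1975) §V.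
-/

noncomputable section

namespace Summit.QuantumFields.YangMills.Theorems.SoftKernelBoostCovariance.Sketch

open scoped BigOperators SchwartzMap InnerProductSpace
open MeasureTheory Filter Topology
open Literature.MathematicalPhysics.QuantumLattice Literature.MathematicalPhysics.AQFT
  Literature.MathematicalPhysics.QuantumFieldTheory
open Summit.QuantumFields.YangMills.Theorems.NPointIsotropy.Negative (E4)
open Summit.QuantumFields.YangMills.Theorems.CurvatureBoostCovariance.Negative
  (OSPackage Translations Hypercubic EightFrameRP PlanarCone PlanarInvariant)
open Summit.QuantumFields.YangMills.Cruxes.PlanarSpectralCone.PositivityDiscToOperatorCone.Density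
  (isTimeOrdered_add fieldVec_add fieldVec_smul fieldVec_congr fieldVec_zero tendsto_fieldVec)

/-- Rotations act linearly on finite linear combinations of test functions. -/
theorem linActMulti_finset_sum_smul {n : ℕ} {ι : Type*} (s : Finset ι) (R : E4 ≃ₗᵢ[ℝ] E4) (lam : ι → ℂ)
    (T : ι → 𝓢((Fin n → E4), ℂ)) :
    linActMulti R (∑ i ∈ s, lam i • T i) = ∑ i ∈ s, lam i • linActMulti R (T i) := by
  simp [map_sum, map_smul]

/-- Norm of a finite linear combination of vectors each bounded by `B`: `≤ (Σ ‖λᵢ‖) · B`. -/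
theorem norm_sum_smul_le_of_le {H : Type*} [SeminormedAddCommGroup H] [NormedSpace ℂ H] {ι : Type*} (s : Finset ι)
    (lam : ι → ℂ) (v : ι → H) {B : ℝ} (hv : ∀ i ∈ s, ‖v i‖ ≤ B) :
    ‖∑ i ∈ s, lam i • v i‖ ≤ (∑ i ∈ s, ‖lam i‖) * B := by
  calc ‖∑ i ∈ s, lam i • v i‖ ≤ ∑ i ∈ s, ‖lam i • v i‖ := norm_sum_le _ _
    _ ≤ ∑ i ∈ s, ‖lam i‖ * B := Finset.sum_le_sum fun i hi => by
        rw [norm_smul]; exact mul_le_mul_of_nonneg_left (hv i hi) (norm_nonneg _)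
    _ = (∑ i ∈ s, ‖lam i‖) * B := (Finset.sum_mul _ _ _).symm

/-- **Stub (Ui) — UNIFORM PLANAR BOOST VECTORS IN EVERY DEGREE** (conclusion (i) of (T*) under (T*)'s hypotheses). -/
theorem stub_asmUniformBoost :
    open Literature.MathematicalPhysics.QuantumLattice Literature.MathematicalPhysics.AQFT
      Literature.MathematicalPhysics.QuantumFieldTheory
      Summit.QuantumFields.YangMills.Theorems.CurvatureBoostCovariance.Negative
      Summit.QuantumFields.YangMills.Theorems.NPointIsotropy.Negative in
    ∀ (S₁ : SchwingerFamily E4) (h : OSReconstructionNoE1 S₁.toLabelled),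
      S₁.toLabelled.HasLinearGrowth → S₁.toLabelled.IsSymmetric → Translations S₁ → EightFrameRP S₁ → PlanarCone S₁ →
      (∃ N : ℂ × ℂ → (h.Hilbert →L[ℂ] h.Hilbert),
          (∀ p : ℂ × ℂ, |p.2.im| < p.1.re → ‖N p‖ ≤ 1) ∧
          (∀ ψ ψ' : h.Hilbert, DifferentiableOn ℂ (fun p : ℂ × ℂ => ⟪ψ, N p ψ'⟫_ℂ) {p : ℂ × ℂ | |p.2.im| < p.1.re}) ∧
          (∀ (t b : ℝ), 0 < t → ∀ ψ : h.Hilbert,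
            N ((t : ℂ), (b : ℂ)) ψ = h.transfer t (h.translate (b • EuclideanSpace.single 1 1) ψ))) →
      ∀ (μ C : ℝ),
        (∀ (u v : ℝ), 0 < u → 0 < v → u ≤ 1 → v ≤ 1 →
           ∀ (f₁ : SchwartzMap (Fin 1 → E4) ℂ) (g hh : ℝ × ℝ → ℂ) (Mg Mh Mh' : ℝ),
             (∀ x : Fin 1 → E4, f₁ x = g (x 0 0, x 0 1) * hh (x 0 2, x 0 3)) →
             (∀ p : ℝ × ℝ, g p ≠ 0 → u ≤ p.1 ∧ p.1 ≤ 2 * u) →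
             MeasureTheory.Integrable g → (∫ p, ‖g p‖) ≤ Mg →
             MeasureTheory.Integrable hh → (∫ p, ‖hh p‖) ≤ Mh → (∀ p, ‖hh p‖ ≤ Mh') →
           ∀ (n : ℕ) (W : SchwartzMap (Fin n → E4) ℂ) (hW : IsTimeOrdered W)
             (hFW : IsTimeOrdered
               (SchwartzMap.appendTensor f₁ (translateMulti ((2 * u + v) • EuclideanSpace.single 0 1) W))),
             ‖h.fieldVec (1 + n) (fun _ => ())
                 (SchwartzMap.appendTensor f₁ (translateMulti ((2 * u + v) • EuclideanSpace.single 0 1) W)) hFW‖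
               ≤ C * Mg * (Mh + Mh') * (u ^ (-μ) + v ^ (-μ)) * ‖h.fieldVec n (fun _ => ()) W hW‖) →
        (∀ (n : ℕ), ∃ N : ℝ, ∀ (F : SchwartzMap (Fin n → E4) ℂ), IsTimeOrdered F →
          HasCompactSupport (F : (Fin n → E4) → ℂ) →
          ∃ ε : ℝ, 0 < ε ∧ ∃ (V : ℂ → h.Hilbert) (C : ℝ),
            DifferentiableOn ℂ V {θ : ℂ | |θ.re| < ε} ∧
            (∀ θ : ℂ, |θ.re| < ε → ‖V θ‖ ≤ C * Real.exp (N * |θ.im|)) ∧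
            ∀ θ : ℝ, |θ| < ε → ∀ hθ : IsTimeOrdered (linActMulti (planeRot (0 : Fin 3) θ) F),
              V θ = h.fieldVec n (fun _ => ()) (linActMulti (planeRot (0 : Fin 3) θ) F) hθ) := by
  intro S₁ h _hlg _hsym _htr _h8 _hC hN μ C hS n
  obtain ⟨N, hN1, hN2, hN3⟩ := hN
  refine ⟨n * |μ|, fun F hF hFc => ?_⟩
  -- Step 1: geometry of `F`
  obtain ⟨δ, L, hδ, hδ1, hL, hK⟩ := geom_margins F hF hFc
  set ε : ℝ := δ / (4 * L) with hε_def
  have hL0 : 0 < L := by linarith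
  have hε : 0 < ε := by positivity
  have hrotF : ∀ θ : ℝ, |θ| < ε → IsTimeOrdered (linActMulti (planeRot (0 : Fin 3) θ) F) :=
    fun θ hθ => isTimeOrdered_rot_of_margins hδ hδ1 hL hK hθ
  -- Step 2: the bump-tensor approximants (T4a-joint with T4b), one per `k`
  obtain ⟨A, M, hAM⟩ := stub_slotProductExpansionJoint stub_radialRiemann n F hFc δ hδ
  have hstep : ∀ k : ℕ, ∃ (ρ : ℝ) (φ : ℝ → ℂ) (I : ℕ) (c : Fin I → Fin n → ℝ × ℝ) (hh : Fin I → Fin n → ℝ × ℝ → ℂ)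
      (f0 : Fin I → Fin n → 𝓢((Fin 1 → E4), ℂ)) (lam : Fin I → ℂ) (T : Fin I → 𝓢((Fin n → E4), ℂ)),
      0 < ρ ∧ ρ ≤ Real.exp (-((k : ℝ) + 1)) * (δ / 32) ∧
      (∀ r : ℝ, ρ ^ 2 < r → φ r = 0) ∧
      MeasureTheory.Integrable (fun p : ℝ × ℝ => φ (p.1 ^ 2 + p.2 ^ 2)) ∧
      (∫ p : ℝ × ℝ, ‖φ (p.1 ^ 2 + p.2 ^ 2)‖) ≤ 1 ∧
      (∀ (i : Fin I) (j : Fin n) (x : Fin 1 → E4), f0 i j x = φ ((x 0 0) ^ 2 + (x 0 1) ^ 2) * hh i j (x 0 2, x 0 3)) ∧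
      (∀ (i : Fin I) (x : Fin n → E4),
        T i x = ∏ j, φ ((x j 0 - (c i j).1) ^ 2 + (x j 1 - (c i j).2) ^ 2) * hh i j (x j 2, x j 3)) ∧
      (∀ i : Fin I, ∃ x ∈ tsupport (F : (Fin n → E4) → ℂ), ∀ j : Fin n,
        |(c i j).1 - x j 0| ≤ δ ∧ |(c i j).2 - x j 1| ≤ δ) ∧
      (∀ (i : Fin I) (j : Fin n), MeasureTheory.Integrable (hh i j) ∧
        (∫ p : ℝ × ℝ, ‖hh i j p‖) ≤ A ∧ ∀ p : ℝ × ℝ, ‖hh i j p‖ ≤ A) ∧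
      (∑ i, ‖lam i‖ ≤ M) ∧
      (∀ p q : ℕ, p ≤ k → q ≤ k → SchwartzMap.seminorm ℝ p q (F - ∑ i, lam i • T i) < 1 / ((k : ℝ) + 1)) := by
    intro k
    obtain ⟨ρ₀, hρ₀, hρ⟩ := hAM ((Finset.range (k + 1)) ×ˢ (Finset.range (k + 1))) (1 / ((k : ℝ) + 1))
      (by positivity)
    have hρpos : 0 < min ρ₀ (Real.exp (-((k : ℝ) + 1)) * (δ / 32)) := lt_min hρ₀ (by positivity)
    obtain ⟨φ, I, c, hh, f0, lam, T, hφ, hφi, hφ1, hf0, hT, hloc, hhh, hlam, herr⟩ :=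
      hρ _ hρpos (min_le_left _ _)
    refine ⟨_, φ, I, c, hh, f0, lam, T, hρpos, min_le_right _ _, hφ, hφi, hφ1, hf0, hT, hloc, hhh, hlam,
      fun p q hp hq => herr (p, q) ?_⟩
    exact Finset.mem_product.2 ⟨Finset.mem_range.2 (by omega), Finset.mem_range.2 (by omega)⟩
  choose ρ φ I c hh f0 lam T hρ hρle hφ hφi hφ1 hf0 hT hloc hhh hlam herr using hstep
  -- Step 3: rotated centres of every term (joint localisation)
  have hgeo : ∀ (k : ℕ) (i : Fin (I k)) (θ : ℝ), |θ| < ε →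
      (∀ j : Fin n, δ ≤ Real.cos θ * (c k i j).1 + Real.sin θ * (c k i j).2) ∧
      (∀ i' j : Fin n, i' < j → δ / 2 ≤ (Real.cos θ * (c k i j).1 + Real.sin θ * (c k i j).2) -
          (Real.cos θ * (c k i i').1 + Real.sin θ * (c k i i').2)) :=
    fun k i θ hθ => (centres_rot hδ hδ1 hL hK (hloc k i)).2 θ hθ
  -- Step 4: reserves `u m = e^{-(m+1)} δ/16` and the chains of every term at every height `m ≤ k`
  set u : ℕ → ℝ := fun m => Real.exp (-((m : ℝ) + 1)) * (δ / 16) with hu_def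
  set Ψ1 : ℝ := ‖h.fieldVec 0 (fun _ => ()) (SchwartzMap.constOfSubsingleton 1)
      OSReconstructionNoE1.isTimeOrdered_constOfSubsingleton‖ with hΨ1_def
  set Kof : ℕ → ℝ := fun m => max (C * 1 * (A + A) * ((u m) ^ (-μ) + (u m) ^ (-μ))) 0 with hKof_def
  have hexp_mono : ∀ {m k : ℕ}, m ≤ k → Real.exp (-((k : ℝ) + 1)) ≤ Real.exp (-((m : ℝ) + 1)) := by
    intro m k hmk
    have hmk' : (m : ℝ) ≤ k := by exact_mod_cast hmk
    exact Real.exp_le_exp.2 (by linarith)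
  have hchain : ∀ (k : ℕ) (i : Fin (I k)) (m : ℕ), m ≤ k →
      (∀ θ : ℝ, |θ| < ε → IsTimeOrdered (linActMulti (planeRot (0 : Fin 3) θ) (T k i))) ∧
      ∃ V : ℂ → h.Hilbert, DifferentiableOn ℂ V {ζ : ℂ | |ζ.re| < ε ∧ |ζ.im| < (m : ℝ) + 1} ∧
        (∀ ζ : ℂ, |ζ.re| < ε → |ζ.im| < (m : ℝ) + 1 → ‖V ζ‖ ≤ (Kof m) ^ n * Ψ1) ∧
        (∀ θ : ℝ, |θ| < ε → ∀ hθ : IsTimeOrdered (linActMulti (planeRot (0 : Fin 3) θ) (T k i)),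
          V θ = h.fieldVec n (fun _ => ()) (linActMulti (planeRot (0 : Fin 3) θ) (T k i)) hθ) := by
    intro k i m hmk
    have h2ρ : 2 * ρ k ≤ u m := by
      have := hρle k
      have := hexp_mono hmk
      have hδ32 : 0 ≤ δ / 32 := by positivity
      calc 2 * ρ k ≤ 2 * (Real.exp (-((k : ℝ) + 1)) * (δ / 32)) := by linarith
        _ ≤ 2 * (Real.exp (-((m : ℝ) + 1)) * (δ / 32)) := by gcongr
        _ = u m := by rw [hu_def]; ring
    have hexp1 : Real.exp (-((m : ℝ) + 1)) ≤ 1 := Real.exp_le_one_iff.2 (by linarith [(Nat.cast_nonneg m : (0 : ℝ) ≤ m)])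
    have hu1 : u m ≤ 1 := by
      calc u m = Real.exp (-((m : ℝ) + 1)) * (δ / 16) := rfl
        _ ≤ 1 * (1 / 16) := mul_le_mul hexp1 (by linarith) (by positivity) zero_le_one
        _ ≤ 1 := by norm_num
    have hres1 : 0 + u m + ρ k ≤ δ * Real.exp (-((m : ℝ) + 1)) := by
      have hρ' : ρ k ≤ Real.exp (-((m : ℝ) + 1)) * (δ / 32) :=
        (hρle k).trans (mul_le_mul_of_nonneg_right (hexp_mono hmk) (by positivity))
      have : 0 ≤ Real.exp (-((m : ℝ) + 1)) := (Real.exp_pos _).le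
      calc 0 + u m + ρ k ≤ Real.exp (-((m : ℝ) + 1)) * (δ / 16) + Real.exp (-((m : ℝ) + 1)) * (δ / 32) := by
            rw [zero_add]; exact add_le_add le_rfl hρ'
        _ ≤ δ * Real.exp (-((m : ℝ) + 1)) := by nlinarith
    have hres2 : 3 * u m ≤ δ / 2 * Real.exp (-((m : ℝ) + 1)) := by
      have : 0 ≤ Real.exp (-((m : ℝ) + 1)) := (Real.exp_pos _).le
      calc 3 * u m = 3 * (Real.exp (-((m : ℝ) + 1)) * (δ / 16)) := rfl
        _ ≤ δ / 2 * Real.exp (-((m : ℝ) + 1)) := by nlinarith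
    have hgaps : ∀ θ : ℝ, |θ| < ε →
        (∀ j : Fin n, (j : ℕ) = 0 →
          δ ≤ Real.cos θ * ((c k i j).1 - ((0 : ℝ), (0 : ℝ)).1) + Real.sin θ * ((c k i j).2 - ((0 : ℝ), (0 : ℝ)).2)) ∧
        (∀ i' j : Fin n, (j : ℕ) = i' + 1 →
          δ / 2 ≤ Real.cos θ * ((c k i j).1 - (c k i i').1) + Real.sin θ * ((c k i j).2 - (c k i i').2)) := by
      intro θ hθ
      obtain ⟨h1, h2⟩ := hgeo k i θ hθ
      refine ⟨fun j _ => by simpa using h1 j, fun i' j hj => ?_⟩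
      have hlt : i' < j := Fin.lt_def.2 (by omega)
      have := h2 i' j hlt
      linarith [this]
    obtain ⟨hTO, V, hVd, hVb, hVr⟩ := stub_asmBumpChainOps S₁ h N hN1 hN2 hN3 μ C hS n (u m) (ρ k) 0 ε ((m : ℝ) + 1)
      δ (δ / 2) A (φ k) (hh k i) (f0 k i) (c k i) ((0 : ℝ), (0 : ℝ)) (T k i) (hρ k) h2ρ hu1 le_rfl hε
      (by positivity) hδ (by positivity) hres1 hres2 (hφ k) (hφi k) (hφ1 k) (hf0 k i) (hT k i) (hhh k i) hgaps
    refine ⟨fun θ hθ => ?_, V, hVd, fun ζ h1 h2 => hVb ζ h1 h2, fun θ hθ hθ' => ?_⟩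
    · have := hTO θ hθ
      rwa [cfg_zero_eq] at this
    · have e := cfg_zero_eq θ (T k i)
      have hθ'' := hθ'
      rw [← e] at hθ''
      rw [hVr θ hθ hθ'']
      exact fieldVec_congr h e hθ'' hθ'
  choose hTO Vt hVd hVb hVr using hchain
  -- Step 5: the approximants `F_k`, their rotations, superposition
  set Fk : ℕ → 𝓢((Fin n → E4), ℂ) := fun k => ∑ i, lam k i • T k i with hFk_def
  have hrotFk : ∀ (k : ℕ) (θ : ℝ), |θ| < ε → IsTimeOrdered (linActMulti (planeRot (0 : Fin 3) θ) (Fk k)) := by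
    intro k θ hθ
    rw [hFk_def, linActMulti_finset_sum_smul]
    exact isTimeOrdered_finset_sum _ _ _ fun i => hTO k i k le_rfl θ hθ
  set V : ℕ → ℕ → ℂ → h.Hilbert := fun k m ζ =>
    if hmk : m ≤ k then ∑ i, lam k i • Vt k i m hmk ζ else 0 with hV_def
  set g : ℕ → ℝ → h.Hilbert := fun k θ =>
    if hθ : |θ| < ε then h.fieldVec n (fun _ => ()) (linActMulti (planeRot (0 : Fin 3) θ) (Fk k)) (hrotFk k θ hθ)
    else 0 with hg_def
  set g' : ℝ → h.Hilbert := fun θ =>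
    if hθ : |θ| < ε then h.fieldVec n (fun _ => ()) (linActMulti (planeRot (0 : Fin 3) θ) F) (hrotF θ hθ)
    else 0 with hg'_def
  -- Step 6: the constants
  have hM0 : 0 ≤ max M 0 := le_max_right _ _
  set K : ℝ := max M 0 * (((4 * |C| * |A| * (δ / 16) ^ (-μ)) * Real.exp |μ|) ^ n * Ψ1) with hK_def
  have hKof_le : ∀ m : ℕ, (Kof m) ^ n ≤ ((4 * |C| * |A| * (δ / 16) ^ (-μ)) * Real.exp |μ|) ^ n *
      Real.exp ((n : ℝ) * |μ| * m) := by
    intro m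
    have := sandwichConst_pow_le (C := C) (A := A) (μ := μ) (u₁ := δ / 16) (by positivity) n
      (m := (m : ℝ) + 1) (y := (m : ℝ)) (by positivity) le_rfl (Nat.cast_nonneg m)
    simpa [hKof_def, hu_def] using this
  have hK0 : 0 ≤ K := by positivity
  -- Step 7: hypotheses of (A1)
  have hdiff : ∀ k m : ℕ, m ≤ k → DifferentiableOn ℂ (V k m) {ζ : ℂ | |ζ.re| < ε ∧ |ζ.im| < (m : ℝ)} := by
    intro k m hmk
    have : V k m = fun ζ => ∑ i, lam k i • Vt k i m hmk ζ := by
      funext ζ; simp [hV_def, hmk]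
    rw [this]
    refine DifferentiableOn.fun_sum fun i _ => ?_
    have hsub : {ζ : ℂ | |ζ.re| < ε ∧ |ζ.im| < (m : ℝ)} ⊆ {ζ : ℂ | |ζ.re| < ε ∧ |ζ.im| < (m : ℝ) + 1} :=
      fun z hz => ⟨hz.1, hz.2.trans (by linarith)⟩
    exact (differentiableOn_const (lam k i)).smul ((hVd k i m hmk).mono hsub)
  have hbd : ∀ k m : ℕ, m ≤ k → ∀ ζ : ℂ, |ζ.re| < ε → |ζ.im| < (m : ℝ) →
      ‖V k m ζ‖ ≤ K * Real.exp ((n : ℝ) * |μ| * m) := by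
    intro k m hmk ζ h1 h2
    have hV : V k m ζ = ∑ i, lam k i • Vt k i m hmk ζ := by simp [hV_def, hmk]
    rw [hV]
    have hterm : ∀ i ∈ Finset.univ, ‖Vt k i m hmk ζ‖ ≤ (Kof m) ^ n * Ψ1 :=
      fun i _ => hVb k i m hmk ζ h1 (h2.trans (by linarith))
    calc ‖∑ i, lam k i • Vt k i m hmk ζ‖ ≤ (∑ i, ‖lam k i‖) * ((Kof m) ^ n * Ψ1) :=
          norm_sum_smul_le_of_le _ _ _ hterm
      _ ≤ max M 0 * ((Kof m) ^ n * Ψ1) :=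
          mul_le_mul_of_nonneg_right ((hlam k).trans (le_max_left _ _)) (by positivity)
      _ ≤ max M 0 * ((((4 * |C| * |A| * (δ / 16) ^ (-μ)) * Real.exp |μ|) ^ n *
            Real.exp ((n : ℝ) * |μ| * m)) * Ψ1) := by
          gcongr
          exact hKof_le m
      _ = K * Real.exp ((n : ℝ) * |μ| * m) := by rw [hK_def]; ring
  have hreal : ∀ k m : ℕ, m ≤ k → ∀ θ : ℝ, |θ| < ε → V k m θ = g k θ := by
    intro k m hmk θ hθ
    have hV : V k m θ = ∑ i, lam k i • Vt k i m hmk θ := by simp [hV_def, hmk]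
    have hg : g k θ = h.fieldVec n (fun _ => ()) (linActMulti (planeRot (0 : Fin 3) θ) (Fk k)) (hrotFk k θ hθ) := by
      simp [hg_def, hθ]
    rw [hV, hg]
    have hsum : IsTimeOrdered (∑ i, lam k i • linActMulti (planeRot (0 : Fin 3) θ) (T k i)) :=
      isTimeOrdered_finset_sum _ _ _ fun i => hTO k i k le_rfl θ hθ
    rw [fieldVec_congr h (linActMulti_finset_sum_smul Finset.univ (planeRot (0 : Fin 3) θ) (lam k) (T k))
      (hrotFk k θ hθ) hsum, fieldVec_finset_sum h Finset.univ (lam k) _ (fun i => hTO k i k le_rfl θ hθ) hsum]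
    exact Finset.sum_congr rfl fun i _ => by rw [hVr k i m hmk θ hθ (hTO k i k le_rfl θ hθ)]
  have hconv : ∀ θ : ℝ, |θ| < ε → Tendsto (fun k => g k θ) atTop (𝓝 (g' θ)) := by
    intro θ hθ
    have hg : (fun k => g k θ) = fun k =>
        h.fieldVec n (fun _ => ()) (linActMulti (planeRot (0 : Fin 3) θ) (Fk k)) (hrotFk k θ hθ) := by
      funext k; simp [hg_def, hθ]
    have hg' : g' θ = h.fieldVec n (fun _ => ()) (linActMulti (planeRot (0 : Fin 3) θ) F) (hrotF θ hθ) := by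
      simp [hg'_def, hθ]
    rw [hg, hg']
    have hFk : Tendsto Fk atTop (𝓝 F) := tendsto_schwartz_of_seminorm F Fk fun k p q hp hq => herr k p q hp hq
    have hlim : Tendsto (fun k => linActMulti (planeRot (0 : Fin 3) θ) (Fk k)) atTop
        (𝓝 (linActMulti (planeRot (0 : Fin 3) θ) F)) :=
      ((linActMulti (planeRot (0 : Fin 3) θ)).continuous.tendsto F).comp hFk
    exact tendsto_fieldVec h (fun k => hrotFk k θ hθ) (hrotF θ hθ) hlim
  -- Step 8: (A1)
  have hN0 : 0 ≤ (n : ℝ) * |μ| := by positivity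
  obtain ⟨W, hWd, hWb, hWr⟩ := stub_asmHeightsVitali h.Hilbert ε K ((n : ℝ) * |μ|) hε hK0 hN0 V g g' hdiff hbd
    hreal hconv
  refine ⟨ε, hε, W, K * Real.exp ((n : ℝ) * |μ|), hWd, fun θ hθ => hWb θ hθ, fun θ hθ hθ' => ?_⟩
  rw [hWr θ hθ]
  simp [hg'_def, hθ]

end Summit.QuantumFields.YangMills.Theorems.SoftKernelBoostCovariance.Sketch

end
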